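import Summits.QuantumFields.BalabanUV.T4Continuum.Support.GradedSubBlocks
import Summits.QuantumFields.BalabanUV.T4Continuum.Support.RegionGaugeResolventSplit

/-!
# T⁴ programme, spine node NE2 (U1a), sub-row Δ1 — THE GRADED WELL, file 2: THE DATA AND THE OPERATOR ON THE TORUS
# `regionGW = ∂*∂ + ∂·R_GW·∂ᴴ + a·Q_GWᴴQ_GW` with GRADED block averagings (scale `s_i = L^{k−i}` on layer `i`, weight
# `L^{2i}·s_i^d`), its LOCAL part `localGW = Σ_ν∇_νᴴ∇_ν + a·Q_GWᴴQ_GW` (exact Weitzenböck — no wall, no electric end) and the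
# resolvent split `regionGW = localGW − B·K⁻¹·Bᴴ` (owner item O16-b; names FIXED for the crew's (GW-·) leaves)

Row NE2 OWNER (unit `b2b-balaban-t4-ne2-p1`, gen 16), item O16-b of RULING R47 (journal 2026-08-21 l.25022), on file 1
`Support/GradedSubBlocks` (O16-a: `Anc`, `meanS`, `avgS`, `shiftAnc`, `avgS_mul_GradOp`).

WHAT IS PRINTED (located in R47 (b); OCR `paper:balaban1984-cmp96-propagators-rt-ii` pp.224–226, `paper:balaban1985-cmp99-background-
propagators` pp.393–395).  [Balaban1984PropagatorsII] (2.1)–(2.3): «Ω₀ ⊃ Ω₁ ⊃ … ⊃ Ω_k», «Ω_j is a union of L^jη-blocks», «Λ_j = Ω_j ∖ Ω_{j+1}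
… for the sets of sites and the sets of bonds» with «Ω also the set of bonds ∪_{x∈Ω} st(x)»; (2.7) «λ = 0 on Λ₀, Q′_jλ = 0 on Λ_j»;
(2.20) «(Q₀A)(b) = A(b) for b ∈ Λ₀»; [Balaban1985BackgroundPropagators] (3.16) «⟨A, Q*aQ A⟩ = Σ_{j=0}^{k} a Σ_{b∈Λ_j} (L^jη)^{d−2}
|(Q_j(U)A)(b)|²», (3.20)–(3.26) (the gauge projection `R` onto `Δ N(Q′)`, `Δ_a = Δ + DRD* + Q*aQ`).  So the carrier `Ω_k` (unit
averaging) sits inside LAYERS `Λ_{k−1}, Λ_{k−2}, …` carrying averagings of the intermediate scales with masses `a·L^{2i}`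
(continuum units) growing OUTWARD; the η-scale layer `Λ₀` and the Dirichlet wall `∂Ω₀` are outermost.

THE MODEL (R47 (c), `U = 1`, model level).  Level `k`, fine torus `Tor (fine n M)`, `n = lev L k`.  Geometry = a LAYER MAP
`layer : Tor M → ℕ` on UNIT blocks (carrier = `{layer = 0}`; layer `i` = print's `Λ_{k−i}`; `i ≤ m`, `m` FIXED).  Scale of layer
`i`: `sGW L k i = lev L (k − i)` fine sites (sub-blocks = level-`i` blocks); weight `wGW L k d i = L^i·√(s_i^d)` (so that
`wGW² = L^{2i}s_i^d = n²·s_i^{d−2}` — (3.16)'s `(L^jη)^{d−2}` in the tree's units; at `s_i = 1` it is the η-collar's `n²`).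
 * scalar rows `RowS`: pairs `(i, z)`, `z` a scale-`s_i` anchor whose unit block lies in layer `i` — `QsGW` = the sub-block means
   ((2.7)'s `Q′_j` on `Λ_j`); `QsGW·QsGWᴴ` is block-diagonal `diag(s_i^{−d})` (rows of distinct scales have disjoint supports);
 * vector rows `RowV`: pairs `(i, (z, μ))` with **`min (layer z) (layer (z + s_i e_μ)) = i`** — PRINT's `st`-CONVENTION read on
   bonds ((2.3): `bonds(Λ_j) = st(Ω_j) ∖ st(Ω_{j+1})`: a scale-`i` contour belongs to layer `i` iff both endpoint blocks lie in layers
   `≥ i` and one of them in layer `i`; interface contours belong to the COARSER side) — `QvGW` = `wGW`-weighted `avgS` rows;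
 * `DpGW = LapS + a′·QsGWwᴴQsGWw` (weighted means), `GOmGW = DpGW⁻¹`, `curlT = 2^{−1/2}·CurlOp`, `gradT = GradOp (fine n M) n`;
 * **`localGW := localFixed curlT gradT QvGW a`**, **`regionGW := gaugeFixed curlT gradT GOmGW QsGW QvGW a`** — ON THE TORUS
   (no compression: print's wall is `k` layers out and exponentially decoupled; R47 (b)(ii), located delta (δ1)).

WHAT THIS FILE PROVES ([folklore] bookkeeping; 0 sorry).  `sGW_dvd` (every scale divides the torus periods — file 1's standing
hypothesis, discharged); `curlT_mul_gradT = 0`; **`localGW_eq : localGW = LapV + a·QvGWᴴQvGW`** (exact torus Weitzenböck: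
the local operator is the COMPONENTWISE Laplacian plus a graded nonnegative potential — no free end anywhere); `form_localGW`;
`DpGW_isHermitian`, `GOmGW_isHermitian`; **`lap_of_ker_GW`** (`QsGW λ = 0 → DpGW λ = gradTᴴ(gradT λ)` — the `lap_of_ker` field of
`SliceData`); **`regionGW_eq_localGW_sub_sandwich`** (the O15 resolvent split, instance: `regionGW = localGW − B·K⁻¹·Bᴴ`,
`B = gaugeB gradT GOmGW QsGW`, `K = gramK GOmGW QsGW`, rank `#RowS` — LEVEL-FREE); `form_regionGW_le_form_localGW`,
`coercive_localGW_of` (given `gramK` invertible).  Two-level objects are the crew's torus tower types VERBATIM: the bond space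
is `B5G183RateUnitTower`'s `Tor (fine (lev L k) M) × Fin d`, King's planting is `KingPairingPlantedLaw.JK (lev L k) L M`.

SOCKETS LEFT DISPLAYED (R47 (e) leaves): (GW-W1) `SliceCoercive curlT gradT GOmGW QsGW QvGW a c` level-uniform; the `avg_grad`
field `QvGW·gradT = Dg₁GW·QsGW` (per row = file 1's `avgS_mul_GradOp` + the means-of-means refinement at interfaces — file 3);
`Coercive DpGW γ′` / `IsUnit (gramK GOmGW QsGW).det`; (GW-L)(GW-B)(GW-Bᵗ)(GW-K) the four two-level leaves of `hinjK_of_local`-shape.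

HONEST FRAMING (T4-DAG p. 1).  Model level (`U = 1`, ONE chain of regions typed by a layer map on UNIT blocks (print: `L^jη`-blocks —
located delta (δ2)), `m` fixed (δ1), finite torus, operator norm); [folklore]; `[cite:]` tags locate SHAPES; nothing printed is a
hypothesis or a conclusion; no estimate in this file; NE2 (U1a) NOT proved; spine PROVED 0/9 unchanged; NOT [B9] (3.16)/(3.23)–(3.27)/
(3.42) as printed; NOT infinite volume / mass gap / Clay.  HONEST DEPENDENCY: continuum YM on T⁴ ⇐ BetaPertH ∧ nine spine estimates
(0/9 proved); BetaPertH ⇐ (D1) ∧ (D4) ∧ CAP+tail; G-an2-4 gates asym, D1 and NE2/3/4.  No `sorry`.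
-/

noncomputable section

open scoped BigOperators ComplexConjugate Matrix Matrix.Norms.L2Operator
open Finset

namespace Summit.QuantumFields.BalabanUV.T4Continuum.GradedWellData

open Literature.MathematicalPhysics.QuantumFieldTheory.Balaban1983to89.B5Prop11Plancherel (Tor fine unitVec)
open Literature.MathematicalPhysics.QuantumFieldTheory.Balaban1983to89.B5Prop11Lower (nsq nsq_nonneg)
open Literature.MathematicalPhysics.QuantumFieldTheory.Balaban1983to89.B5Block118 (tstep)
open Literature.MathematicalPhysics.QuantumFieldTheory.Balaban1983to89.B5Blocks16 (blockOf)
open Literature.MathematicalPhysics.QuantumFieldTheory.Balaban1983to89.B5Action121 (GradOp CurlOp LapS LapV curl_adjoint_curl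
  GradOp_conjTranspose_mul_GradOp)
open Literature.MathematicalPhysics.QuantumFieldTheory.Balaban1983to89.B5G183RateUnitTower (lev lev_neZero)
open Summit.QuantumFields.BalabanUV.T4Continuum
open Summit.QuantumFields.BalabanUV.T4Continuum.SubtypeCompression (Coercive)
open Summit.QuantumFields.BalabanUV.T4Continuum.RegionGaugeProjection (gramK gaugeP gaugeR)
open Summit.QuantumFields.BalabanUV.T4Continuum.RegionGaugeSlice (gaugeFixed form_gaugeFixed form_gram)
open Summit.QuantumFields.BalabanUV.T4Continuum.RegionGaugeFixedVector (CurlOp_mulVec_GradOp)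
open Summit.QuantumFields.BalabanUV.T4Continuum.RegionGaugeResolventSplit (localFixed gaugeB form_localFixed localFixed_isHermitian
  gaugeFixed_eq_localFixed_sub_sandwich form_gaugeFixed_le_form_localFixed coercive_localFixed_of)
open Summit.QuantumFields.BalabanUV.T4Continuum.GradedSubBlocks (Anchor Anc meanS avgS shiftAnc)

variable {d : ℕ} (L : ℕ) [NeZero L] (M : Fin d → ℕ) [hM : ∀ μ, NeZero (M μ)] (k m : ℕ) (layer : Tor M → ℕ) (a a' : ℝ)

/-! ## §1 Scales, weights, row index types -/

omit [NeZero L] in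
/-- `lev L j = L^j`. [folklore] -/
theorem lev_eq_pow (j : ℕ) : lev L j = L ^ j := by
  induction j with
  | zero => rfl
  | succ j ih =>
      show L * lev L j = L ^ (j + 1)
      rw [ih, pow_succ, mul_comm]

/-- THE SCALE OF LAYER `i` at level `k`: sub-blocks of side `s_i = L^{k−i}` fine sites (= the blocks of the level-`i` lattice;
`s_0 = n` on the carrier). [cite: Balaban1984PropagatorsII, (2.1) p.224 (shape: «Ω_j is a union of L^jη-blocks»)] [folklore] -/
def sGW (i : ℕ) : ℕ := lev L (k - i)

/-- every scale is a nonzero natural. [folklore] -/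
instance sGW_neZero (i : ℕ) : NeZero (sGW L k i) := inferInstanceAs (NeZero (lev L (k - i)))

omit [NeZero L] hM in
/-- **every scale divides the torus periods**: `s_i ∣ n·M_ν` (file 1's standing hypothesis `hs`, discharged). [folklore] -/
theorem sGW_dvd (i : ℕ) (ν : Fin d) : sGW L k i ∣ fine (lev L k) M ν := by
  show lev L (k - i) ∣ lev L k * M ν
  rw [lev_eq_pow, lev_eq_pow]
  exact Dvd.dvd.mul_right (Nat.pow_dvd_pow L (Nat.sub_le k i)) _

/-- THE WEIGHT OF LAYER `i`: `w_i = L^i·√(s_i^d)`, `w_i² = L^{2i}·s_i^d` (= `n²·s_i^{d−2}`: (3.16)'s `(L^jη)^{d−2}` in the tree's units;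
`w_0² = n^d` = the unit mass normalisation of `regionDeltaA`, and `n²` at `s_i = 1` = the η-collar's).
[cite: Balaban1985BackgroundPropagators, (3.16) p.393 (shape: the weights)] [folklore] -/
def wGW (dd i : ℕ) : ℝ := (L : ℝ) ^ i * Real.sqrt (((sGW L k i : ℕ) : ℝ) ^ dd)

omit [NeZero L] in
/-- `0 ≤ w_i`. [folklore] -/
theorem wGW_nonneg (dd i : ℕ) : 0 ≤ wGW L k dd i :=
  mul_nonneg (pow_nonneg (Nat.cast_nonneg _) _) (Real.sqrt_nonneg _)

omit [NeZero L] in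
/-- `w_i² = L^{2i}·s_i^d`. [folklore] -/
theorem wGW_sq (dd i : ℕ) : wGW L k dd i ^ 2 = (L : ℝ) ^ (2 * i) * ((sGW L k i : ℕ) : ℝ) ^ dd := by
  unfold wGW
  rw [mul_pow, Real.sq_sqrt (pow_nonneg (Nat.cast_nonneg _) _), ← pow_mul, mul_comm i 2]

/-- the level-`k` fine torus of the model. [folklore] -/
abbrev TorK : Type := Tor (fine (lev L k) M)

/-- **SCALAR ROWS**: `(i, z)` with `z` a scale-`s_i` anchor whose unit block lies in layer `i` ((2.7)'s `Q′_j` on `Λ_j`).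
[cite: Balaban1984PropagatorsII, (2.7) p.225 (shape)] [folklore] -/
abbrev RowS : Type :=
  {p : (i : Fin (m + 1)) × Anc (fine (lev L k) M) (sGW L k i) // layer (blockOf (lev L k) M p.2.1) = p.1}

/-- **VECTOR ROWS** (print's `st`-convention on bonds): `(i, (z, μ))` with `min (layer of z's block) (layer of the block of
z + s_i e_μ) = i` — the scale-`i` contour `[z, z + s_i e_μ]` belongs to layer `i` iff both endpoint blocks lie in layers `≥ i` and one
of them in layer `i` ((2.3) «Λ_j = Ω_j ∖ Ω_{j+1} … for the sets of bonds», «st(x)»: interface contours belong to the COARSER side).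
[cite: Balaban1984PropagatorsII, (2.3) p.224 (shape)] [folklore] -/
abbrev RowV : Type :=
  {p : (i : Fin (m + 1)) × (Anc (fine (lev L k) M) (sGW L k i) × Fin d) //
    min (layer (blockOf (lev L k) M p.2.1.1))
        (layer (blockOf (lev L k) M (shiftAnc (fine (lev L k) M) (sGW L k p.1) (sGW_dvd L M k p.1) p.2.2 p.2.1).1)) = p.1}

/-! ## §2 The graded averagings, the scalar data, the operators -/

/-- **THE GRADED SCALAR MEANS `Q′_GW`** (unweighted rows; `ker Q′_GW = N(Q′)` of (2.7) for this layer map).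
[cite: Balaban1984PropagatorsII, (2.7) p.225 (shape)] [folklore] -/
def QsGW : Matrix (RowS L M k m layer) (TorK L M k) ℂ :=
  fun p y => meanS (fine (lev L k) M) (sGW L k p.1.1) p.1.2 y

/-- the WEIGHTED scalar means `w_i·Q′_{s_i}` (for the scalar mass `a′·Σ_i w_i²‖Q′_{s_i}λ‖²`). [folklore] -/
def QsGWw : Matrix (RowS L M k m layer) (TorK L M k) ℂ :=
  fun p y => ((wGW L k d p.1.1 : ℝ) : ℂ) * QsGW L M k m layer p y

/-- **THE GRADED VECTOR AVERAGING `Q_GW`** (weighted rows `w_i·Q_{s_i}`, so that `a·‖Q_GW A‖² = a·Σ_i L^{2i}s_i^d Σ_{rows}|Q_{s_i}A|²` is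
(3.16) at `U = 1` for this layer map). [cite: Balaban1985BackgroundPropagators, (3.16) p.393 (shape)] [folklore] -/
def QvGW : Matrix (RowV L M k m layer) (TorK L M k × Fin d) ℂ :=
  fun p b => ((wGW L k d p.1.1 : ℝ) : ℂ) * avgS (fine (lev L k) M) (sGW L k p.1.1) p.1.2 b

/-- the torus gradient at level `k` (factor `n`). [folklore] -/
abbrev gradT : Matrix (TorK L M k × Fin d) (TorK L M k) ℂ := GradOp (fine (lev L k) M) ((lev L k : ℕ) : ℂ)

/-- the torus curl at level `k`, scaled by `2^{−1/2}` (the tree's `CurlOp` runs over ORDERED pairs; cf. `RegionGaugeFixedVector.curlR`).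
[cite: Balaban1984PropagatorsI, (1.2) p.18 (shape)] [folklore] -/
def curlT : Matrix (TorK L M k × (Fin d × Fin d)) (TorK L M k × Fin d) ℂ :=
  (((Real.sqrt 2)⁻¹ : ℝ) : ℂ) • CurlOp (fine (lev L k) M) ((lev L k : ℕ) : ℂ)

/-- **THE GRADED SCALAR OPERATOR `Δ′_GW = −Δ + a′·Q′_GWwᴴQ′_GWw`** ((3.24)'s `Δ^η_U + Q′*aQ′` at `U = 1` with graded means).
[cite: Balaban1985BackgroundPropagators, (3.24) p.394 (shape)] [folklore] -/
def DpGW : Matrix (TorK L M k) (TorK L M k) ℂ :=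
  LapS (fine (lev L k) M) ((lev L k : ℕ) : ℂ) + (a' : ℂ) • ((QsGWw L M k m layer)ᴴ * QsGWw L M k m layer)

/-- `G′_GW = (Δ′_GW)⁻¹`. [cite: Balaban1985BackgroundPropagators, (3.25) p.394 (shape: G′)] [folklore] -/
def GOmGW : Matrix (TorK L M k) (TorK L M k) ℂ := (DpGW L M k m layer a')⁻¹

/-- **THE LOCAL GRADED-WELL OPERATOR** `localGW = curlᴴcurl + ∂∂ᴴ + a·Q_GWᴴQ_GW` on the torus. [cite: Balaban1985BackgroundPropagators, (3.26) p.395 (shape, R ↦ 1)] [folklore] -/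
def localGW : Matrix (TorK L M k × Fin d) (TorK L M k × Fin d) ℂ :=
  localFixed (curlT L M k) (gradT L M k) (QvGW L M k m layer) a

/-- **THE FAITHFUL GRADED-WELL OPERATOR** `regionGW = curlᴴcurl + ∂·R_GW·∂ᴴ + a·Q_GWᴴQ_GW` with Bałaban's projection `R_GW`
((3.25) for the graded scalar data) — ON THE TORUS, no compression. [cite: Balaban1985BackgroundPropagators, (3.26) p.395 (shape)] [folklore] -/
def regionGW : Matrix (TorK L M k × Fin d) (TorK L M k × Fin d) ℂ :=
  gaugeFixed (curlT L M k) (gradT L M k) (GOmGW L M k m layer a') (QsGW L M k m layer) (QvGW L M k m layer) a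

/-! ## §3 Structural identities -/

/-- curl ∘ grad = 0 on the torus. [cite: Balaban1984PropagatorsI, (1.4) p.18 (shape)] [folklore] -/
theorem curlT_mul_gradT : curlT L M k * gradT L M k = 0 := by
  unfold curlT
  rw [Matrix.smul_mul]
  have h : CurlOp (fine (lev L k) M) ((lev L k : ℕ) : ℂ) * GradOp (fine (lev L k) M) ((lev L k : ℕ) : ℂ) = 0 := by
    funext p y
    have h1 := congrFun (CurlOp_mulVec_GradOp (fine (lev L k) M) ((lev L k : ℕ) : ℂ) (Pi.single y 1)) p
    rwa [Matrix.mulVec_mulVec, Matrix.mulVec_single_one, Matrix.col_apply, Pi.zero_apply] at h1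
  rw [h, smul_zero]

/-- `curlTᴴ·curlT = Σ_ν∇_νᴴ∇_ν − ∂∂ᴴ` («∂*∂ = Δ − ∂∂*» on the torus). [cite: Balaban1984PropagatorsI, (1.69) p.29 (shape)] [folklore] -/
theorem curlT_conjTranspose_mul_curlT :
    (curlT L M k)ᴴ * curlT L M k = LapV (fine (lev L k) M) ((lev L k : ℕ) : ℂ) - gradT L M k * (gradT L M k)ᴴ := by
  have hs : star ((((Real.sqrt 2)⁻¹ : ℝ) : ℂ)) * (((Real.sqrt 2)⁻¹ : ℝ) : ℂ) * 2 = 1 := by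
    rw [Complex.star_def, Complex.conj_ofReal, ← Complex.ofReal_mul, ← sq, inv_pow, Real.sq_sqrt (by norm_num : (0:ℝ) ≤ 2)]
    push_cast; norm_num
  unfold curlT
  rw [Matrix.conjTranspose_smul, Matrix.smul_mul, Matrix.mul_smul, smul_smul, curl_adjoint_curl, smul_smul, hs, one_smul]

/-- **THE LOCAL OPERATOR IS THE COMPONENTWISE LAPLACIAN PLUS THE GRADED POTENTIAL**: `localGW = Σ_ν∇_νᴴ∇_ν + a·Q_GWᴴQ_GW`
(exact torus Weitzenböck — no wall, no electric free end, no corner of a boundary condition). [cite: Balaban1984PropagatorsI, (1.69) p.29 (shape)] [folklore] -/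
theorem localGW_eq :
    localGW L M k m layer a
      = LapV (fine (lev L k) M) ((lev L k : ℕ) : ℂ) + (a : ℂ) • ((QvGW L M k m layer)ᴴ * QvGW L M k m layer) := by
  unfold localGW localFixed
  rw [curlT_conjTranspose_mul_curlT, sub_add_cancel]

/-- `localGW` is Hermitian. [folklore] -/
theorem localGW_isHermitian : (localGW L M k m layer a).IsHermitian := localFixed_isHermitian _ _ _ _

/-- `Re⟨A, localGW A⟩ = ‖curl A‖²/… + ‖∂ᴴA‖² + a‖Q_GW A‖²`. [cite: Balaban1984PropagatorsI, (1.69) p.29 (shape)] [folklore] -/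
theorem form_localGW (A : TorK L M k × Fin d → ℂ) :
    (star A ⬝ᵥ (localGW L M k m layer a *ᵥ A)).re
      = nsq (curlT L M k *ᵥ A) + nsq ((gradT L M k)ᴴ *ᵥ A) + a * nsq (QvGW L M k m layer *ᵥ A) :=
  form_localFixed _ _ _ _ A

/-- the scalar mass is Hermitian-symmetric: `Δ′_GW` is Hermitian. [folklore] -/
theorem DpGW_isHermitian : (DpGW L M k m layer a').IsHermitian := by
  unfold DpGW Matrix.IsHermitian
  rw [Matrix.conjTranspose_add, Matrix.conjTranspose_smul, Matrix.conjTranspose_mul, Matrix.conjTranspose_conjTranspose,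
    Complex.star_def, Complex.conj_ofReal, ← GradOp_conjTranspose_mul_GradOp, Matrix.conjTranspose_mul,
    Matrix.conjTranspose_conjTranspose]

/-- `G′_GW` is Hermitian. [folklore] -/
theorem GOmGW_isHermitian : (GOmGW L M k m layer a').IsHermitian := (DpGW_isHermitian L M k m layer a').inv

/-- **on `N(Q′_GW)` the scalar operator is the Laplacian**: `Q′_GW λ = 0 → Δ′_GW λ = ∂ᴴ(∂λ)` (the `lap_of_ker` field of `SliceData`).
[cite: Balaban1984PropagatorsII, (2.7) p.225 (shape: N(Q′))] [folklore] -/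
theorem lap_of_ker_GW (lam : TorK L M k → ℂ) (h : QsGW L M k m layer *ᵥ lam = 0) :
    DpGW L M k m layer a' *ᵥ lam = (gradT L M k)ᴴ *ᵥ (gradT L M k *ᵥ lam) := by
  have hw : QsGWw L M k m layer *ᵥ lam = 0 := by
    funext p
    have hp := congrFun h p
    simp only [Matrix.mulVec, dotProduct, Pi.zero_apply] at hp ⊢
    have e : ∑ x, QsGWw L M k m layer p x * lam x = ((wGW L k d p.1.1 : ℝ) : ℂ) * ∑ x, QsGW L M k m layer p x * lam x := by
      rw [Finset.mul_sum]
      refine Finset.sum_congr rfl fun x _ => ?_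
      simp only [QsGWw]
      ring
    rw [e, hp, mul_zero]
  unfold DpGW
  rw [Matrix.add_mulVec, Matrix.smul_mulVec, ← Matrix.mulVec_mulVec, hw, Matrix.mulVec_zero, smul_zero, add_zero,
    ← GradOp_conjTranspose_mul_GradOp, Matrix.mulVec_mulVec]

/-- **THE RESOLVENT SPLIT OF THE GRADED WELL** (O15's `gaugeFixed_eq_localFixed_sub_sandwich`, instance):
`regionGW = localGW − B·K⁻¹·Bᴴ`, `B = ∂·G′_GW·Q′_GWᴴ` (ONE column per scalar row — `#RowS`, LEVEL-FREE), `K = Q′_GW G′_GW² Q′_GWᴴ`.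
[cite: Balaban1985BackgroundPropagators, (3.25)–(3.26) pp.394–395 (shape)] [folklore] -/
theorem regionGW_eq_localGW_sub_sandwich :
    regionGW L M k m layer a a'
      = localGW L M k m layer a
          - gaugeB (gradT L M k) (GOmGW L M k m layer a') (QsGW L M k m layer)
              * (gramK (GOmGW L M k m layer a') (QsGW L M k m layer))⁻¹
              * (gaugeB (gradT L M k) (GOmGW L M k m layer a') (QsGW L M k m layer))ᴴ :=
  gaugeFixed_eq_localFixed_sub_sandwich _ _ _ _ _ _ (GOmGW_isHermitian L M k m layer a')

/-- **`regionGW ≤ localGW` AS FORMS** (‖R‖ ≤ 1), given `K` invertible. [folklore] -/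
theorem form_regionGW_le_form_localGW (hK : IsUnit (gramK (GOmGW L M k m layer a') (QsGW L M k m layer)).det)
    (A : TorK L M k × Fin d → ℂ) :
    (star A ⬝ᵥ (regionGW L M k m layer a a' *ᵥ A)).re ≤ (star A ⬝ᵥ (localGW L M k m layer a *ᵥ A)).re :=
  form_gaugeFixed_le_form_localFixed _ _ _ _ _ _ (GOmGW_isHermitian L M k m layer a') hK A

/-- hence every coercivity constant of `regionGW` is one of `localGW`. [folklore] -/
theorem coercive_localGW_of (hK : IsUnit (gramK (GOmGW L M k m layer a') (QsGW L M k m layer)).det) {γ : ℝ}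
    (h : Coercive (regionGW L M k m layer a a') γ) : Coercive (localGW L M k m layer a) γ :=
  coercive_localFixed_of _ _ _ _ _ _ (GOmGW_isHermitian L M k m layer a') hK h

/-- the local form dominates the graded potential: `a·‖Q_GW A‖² ≤ Re⟨A, localGW A⟩`. [folklore] -/
theorem mass_le_form_localGW (A : TorK L M k × Fin d → ℂ) :
    a * nsq (QvGW L M k m layer *ᵥ A) ≤ (star A ⬝ᵥ (localGW L M k m layer a *ᵥ A)).re := by
  rw [form_localGW]
  have h1 := nsq_nonneg (curlT L M k *ᵥ A)
  have h2 := nsq_nonneg ((gradT L M k)ᴴ *ᵥ A)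
  linarith

/-- the local form dominates the FULL gradient energy of every component: `Re⟨A, Σ_ν∇_νᴴ∇_ν A⟩ ≤ Re⟨A, localGW A⟩` (`0 ≤ a`) — the
interior-W2 budget with constant `1`, no region hypothesis. [folklore] -/
theorem form_LapV_le_form_localGW (ha : 0 ≤ a) (A : TorK L M k × Fin d → ℂ) :
    (star A ⬝ᵥ (LapV (fine (lev L k) M) ((lev L k : ℕ) : ℂ) *ᵥ A)).re ≤ (star A ⬝ᵥ (localGW L M k m layer a *ᵥ A)).re := by
  rw [localGW_eq, Matrix.add_mulVec, dotProduct_add, Complex.add_re, Matrix.smul_mulVec, dotProduct_smul, form_gram,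
    smul_eq_mul, ← Complex.ofReal_mul, Complex.ofReal_re]
  have := mul_nonneg ha (nsq_nonneg (QvGW L M k m layer *ᵥ A))
  linarith

end Summit.QuantumFields.BalabanUV.T4Continuum.GradedWellData

end
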